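import Summits.Ventures.HodgeRepro2.T6NAut2
import Summits.Ventures.HodgeRepro2.T6N3Adm
import Summits.Ventures.HodgeRepro2.T6N3Bridge
import Summits.Ventures.HodgeRepro2.T6N3Mult

/-!
# T6N3Main2 — the N3 isotypic step of the M2 composition, v2: over `(M : NAut2 F P)`, in the DATA form
with the N2-ADMISSIBLE witness (with the WEAKEST form of the sentence N2 and N3 share, `AdmGenerating`)

Cell pub-hodge-repro2, Tier 6 (README §10), seat t6-p3 (N3 owner, M2). Proof lane. The lead's v2
carrier `NAut2 F P` (T6NAut2, STATUS l. 5186) consumes N3's isotypic step as the binder `hN3iso` of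
`periodInputN_of_mains₂`:
`M.ellA → M.ellB → ∃ φa φb φc φd, M.AdmData (φa, φb, φc, φd) ∧ ⟪M.d3.B.F φc φd, M.d3.A.F φa φb⟫_ℂ ≠ 0`
— the witness quadruple must be ADMISSIBLE DATA of the N2 datum `M.d2` (each component in the line's
admissible set `admA … admD`), and the passage to an admissible choice `c` of the period datum is the
lead's `NAut2.exists_choice_of_pairing_ne_zero` (consuming `hN2 : M.AdmDatum`). `N3iso_main₂` below is
that binder EXACTLY, with v1's binders (`N3Main.N3iso_main`, T6N3Main: the Rogawski displays on the
packet carrier, the dictionary `hRbr`, the interface Props of N3.L8) plus ONE: the sentence N2 and N3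
share, `M.d2.AdmGenerating` (defined in §1 below, the append-protocol companion of T6N3Adm p403091:
on each side every single product of vertex forms is a linear combination of single products of
ADMISSIBLE data, i.e. the admissible product module `productModuleOn` is the full `productModule` —
the kernel form of TIER4 Lemma A7.3(b)'s multilinearity («(N) for SOME admissible choice iff for a
GENERIC one»; the host's admissible Schwartz data are the data of B7(b)'s choices, whose vertex forms
generate every vertex form linearly by Liu Thm. 4.18(1), while they need not span the Schwartz spaces
themselves) and of N3.L8's own reading of «admissible data», TIER5 ll. 783 / 846 / N3.9.5); the
stronger spanning sentence `M.d2.AdmSpanning` (T6N3Adm) gives it (`admGenerating_of_admSpanning`,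
`N3iso_main₂_of_admSpanning`), and on t6-p5's
toy `T6N2Toy` (`admA = … = Set.univ`) it is discharged outright (`N3iso_main₂_of_univ`). The
stable-route form (`N3iso_main₂_stable`: `AdmStable` + `ℓ^σ ≢ 0` on admissible products) is given for
the case of a host instantiation whose admissible products generate a proper submodule. The N3A / N3B
mains of v1 apply to a v2 carrier through the lead's forgetful view `NAut2.toNAut'` (T6NAut2View)
unchanged.

§8(d): uses an L-value-free non-vanishing device: NO.
-/

namespace Summit.Ventures.HodgeRepro2.T6

open scoped InnerProductSpace

namespace N3Datum

variable (𝒟 : N3Datum)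

/-! ## 1. The sentence N2 and N3 share, weakest form, and the assembly under it -/

/-- N3.L8 (ASSEMBLY) WITH THE GENERATING SENTENCE: if on each side the admissible single products
generate the full product module (`M_X(S_a, S_b) = M_X`), then `ℓ_A^σ ≢ 0 ∧ ℓ_B^σ ≢ 0` on `σ^τ` (the
same `σ`) gives single products of ADMISSIBLE data with `⟨F_X, F_Y⟩ ≠ 0` — v1's
`exists_pairing_ne_zero` with the witness located in `S_a × S_b × S_c × S_d`
(`exists_pairing_ne_zero_of_span_top` with the spanning hypotheses replaced by their consequence). -/
theorem exists_pairing_ne_zero_of_productModuleOn_eq (hO : 𝒟.AutOrthogonal) (hst : 𝒟.AutStable)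
    (hsimp : 𝒟.AutSimple) (hnon : 𝒟.AutNonIso hst) (X Y : N3Side 𝒟.LG 𝒟.Gf)
    (hPX : 𝒟.ProductsIn20 X) (hPeqX : 𝒟.ProductEquivariant X) (hPY : 𝒟.ProductsIn20 Y)
    (hPeqY : 𝒟.ProductEquivariant Y) (hσX : 𝒟.SigmaIsAut X) (hσ : Y.σ = X.σ)
    {SA : Set X.Sa} {SB : Set X.Sb} {SC : Set Y.Sa} {SD : Set Y.Sb}
    (hXeq : 𝒟.productModuleOn X SA SB = 𝒟.productModule X)
    (hYeq : 𝒟.productModuleOn Y SC SD = 𝒟.productModule Y)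
    (hA : 𝒟.ellNonzero X) (hB : 𝒟.ellNonzero Y) :
    ∃ φa ∈ SA, ∃ φb ∈ SB, ∃ φc ∈ SC, ∃ φd ∈ SD, ⟪Y.F φc φd, X.F φa φb⟫_ℂ ≠ 0 := by
  obtain ⟨i₀, hi₀⟩ := hσX
  have hA' : 𝒟.tauPart i₀ ≤ 𝒟.productModuleOn X SA SB := by
    rw [hXeq]
    exact 𝒟.tauPart_le_productModule hO hst hsimp hnon X hPX hPeqX hi₀ hA
  have hB' : 𝒟.tauPart i₀ ≤ 𝒟.productModuleOn Y SC SD := by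
    rw [hYeq]
    exact 𝒟.tauPart_le_productModule hO hst hsimp hnon Y hPY hPeqY (hi₀.trans hσ.symm) hB
  obtain ⟨φa, φb, ψ, hψ, hne⟩ := hA
  have hψσ : ψ ∈ 𝒟.tauPart i₀ := ⟨by rw [hi₀]; exact hψ.1, hψ.2⟩
  have hψ0 : ψ ≠ 0 := fun h => hne (by
    show ⟪ψ, X.F φa φb⟫_ℂ = 0
    rw [h, inner_zero_left])
  exact 𝒟.exists_pairing_ne_zero_on X Y hA' hB' hψσ hψ0

end N3Datum

namespace N2Datum

variable {K : Type*} [Field K] [NumberField K] {F : FaceSetting K} {P : NDatum F} {𝒟 : N3Datum}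
  (D : N2Datum F P 𝒟)

/-- [interface: N3.L8 «admissible data (in the sense of B7(b), finite Schwartz data pure tensors, any
level)» ↔ N2's admissible sets `admA … admD` of the four lines, through TIER4 Lemma A7.3(b) (the
period is multilinear in the admissible choices, «(N) for SOME admissible choice iff for a GENERIC
one») — THE SENTENCE N2 AND N3 SHARE, weakest form: on each side, every single product of vertex
forms is a linear combination of single products of ADMISSIBLE data, i.e. the admissible product
module is the full product module `M_A` (resp. `M_B`); class AD (implied by `AdmSpanning`; on
t6-p5's toy `T6N2Toy`, `admA = … = Set.univ`, it holds outright)] -/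
def AdmGenerating : Prop :=
  𝒟.productModuleOn 𝒟.A D.admA D.admB = 𝒟.productModule 𝒟.A ∧
    𝒟.productModuleOn 𝒟.B D.admC D.admD = 𝒟.productModule 𝒟.B

/-- Spanning admissible data generate the product modules (bilinearity of `F`):
`AdmSpanning → AdmGenerating`. -/
theorem admGenerating_of_admSpanning (h : D.AdmSpanning) : D.AdmGenerating :=
  ⟨𝒟.productModuleOn_eq_productModule_of_span_top 𝒟.A h.1 h.2.1,
    𝒟.productModuleOn_eq_productModule_of_span_top 𝒟.B h.2.2.1 h.2.2.2⟩

/-- N3iso IN THE DATA FORM WITH THE N2-ADMISSIBLE WITNESS under the WEAKEST sentence (generating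
route): `ℓ_A^σ ≢ 0 ∧ ℓ_B^σ ≢ 0 ⟹ ∃ (φ_a, φ_b, φ_c, φ_d)` ADMISSIBLE DATA with
`⟨F_A(φ_a, φ_b), F_B(φ_c, φ_d)⟩ ≠ 0` — T6N3Adm's `N3iso_of_datum₂` with `AdmSpanning` weakened to
`AdmGenerating`. -/
theorem N3iso_of_datum₂_gen (hAdm : D.AdmGenerating) (hO : 𝒟.AutOrthogonal) (hst : 𝒟.AutStable)
    (hsimp : 𝒟.AutSimple) (hnon : 𝒟.AutNonIso hst) (hPX : 𝒟.ProductsIn20 𝒟.A)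
    (hPeqX : 𝒟.ProductEquivariant 𝒟.A) (hPY : 𝒟.ProductsIn20 𝒟.B)
    (hPeqY : 𝒟.ProductEquivariant 𝒟.B) (hσX : 𝒟.SigmaIsAut 𝒟.A) (hσ : 𝒟.B.σ = 𝒟.A.σ) :
    𝒟.ellNonzero 𝒟.A → 𝒟.ellNonzero 𝒟.B →
      ∃ (φa : 𝒟.A.Sa) (φb : 𝒟.A.Sb) (φc : 𝒟.B.Sa) (φd : 𝒟.B.Sb),
        D.AdmData (φa, φb, φc, φd) ∧ ⟪𝒟.B.F φc φd, 𝒟.A.F φa φb⟫_ℂ ≠ 0 := by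
  intro hA hB
  obtain ⟨φa, ha, φb, hb, φc, hc, φd, hd, hne⟩ :=
    𝒟.exists_pairing_ne_zero_of_productModuleOn_eq hO hst hsimp hnon 𝒟.A 𝒟.B hPX hPeqX hPY hPeqY
      hσX hσ hAdm.1 hAdm.2 hA hB
  exact ⟨φa, φb, φc, φd, ⟨ha, hb, hc, hd⟩, hne⟩

end N2Datum

end Summit.Ventures.HodgeRepro2.T6

/-! ## 2. The N3 isotypic step over the v2 carrier -/

namespace Summit.Ventures.HodgeRepro2.T6.N3Main

open scoped InnerProductSpace

variable {K : Type*} [Field K] [NumberField K] [NumberField.IsCMField K] {F : FaceSetting K}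
  {P : NDatum F} (M : NAut2 F P)

/-- N3iso, v2 (N3.L8, the assembly, in the DATA form with the N2-ADMISSIBLE witness): `ℓ_A^σ ≢ 0 ∧
ℓ_B^σ ≢ 0 ⟹ ∃ (φ_a, φ_b, φ_c, φ_d)` admissible data of the N2 datum with `⟨F_A, F_B⟩ ≠ 0` — the
binder `hN3iso` of the lead's `periodInputN_of_mains₂`. Displays consumed by name: Rogawski 1990 §14.6
(the partition sentence, Theorem 14.6.4, Theorem 14.6.5) on the packet carrier `R` — giving `m ≤ 1` on
`U(V)` through `multLeOne_of_displays` with the Π_s binder `hs` (the record's residual [G-N3-3], class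
AD) — and the dictionary `hRbr` (T6N3Bridge, class AD) to the non-isomorphism of the τ-parts. Residual
binders (class AD, T6N3Interface): `hO`, `hst`, `hsimp`, `hPX`, `hPeqX`, `hPY`, `hPeqY`, `hσX`, `hσ :
Θ_V(π₀′) = σ`; and the sentence N2 and N3 share, `hAdm : M.d2.AdmGenerating` (class AD; outright on
the toy). -/
theorem N3iso_main₂ (hAdm : M.d2.AdmGenerating) (R : RogawskiPackets)
    (hR0 : Hyp.Rogawski1990_Sec14_6_Partition R) (hR1 : Hyp.Rogawski1990_Thm14_6_4 R)
    (hR2 : Hyp.Rogawski1990_Thm14_6_5 R) (hs : ∀ P' ∈ R.Ps, ∀ π, R.mem π P' → R.m π ≤ 1)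
    (hst : M.d3.AutStable) (hRbr : M.d3.RogawskiBridge R hst) (hO : M.d3.AutOrthogonal)
    (hsimp : M.d3.AutSimple) (hPX : M.d3.ProductsIn20 M.d3.A)
    (hPeqX : M.d3.ProductEquivariant M.d3.A) (hPY : M.d3.ProductsIn20 M.d3.B)
    (hPeqY : M.d3.ProductEquivariant M.d3.B) (hσX : M.d3.SigmaIsAut M.d3.A)
    (hσ : M.d3.B.σ = M.d3.A.σ) :
    M.ellA → M.ellB →
      ∃ (φa : M.d3.A.Sa) (φb : M.d3.A.Sb) (φc : M.d3.B.Sa) (φd : M.d3.B.Sb),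
        M.AdmData (φa, φb, φc, φd) ∧ ⟪M.d3.B.F φc φd, M.d3.A.F φa φb⟫_ℂ ≠ 0 := by
  intro hA hB
  have hnon : M.d3.AutNonIso hst := hRbr (R.multLeOne_of_displays hR0 hR1 hR2 hs)
  exact M.d2.N3iso_of_datum₂_gen hAdm hO hst hsimp hnon hPX hPeqX hPY hPeqY hσX hσ hA hB

/-- `N3iso_main₂` under the STRONGER spanning sentence `M.d2.AdmSpanning` (the admissible Schwartz
data of each line span the line's finite Schwartz space). -/
theorem N3iso_main₂_of_admSpanning (hAdm : M.d2.AdmSpanning) (R : RogawskiPackets)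
    (hR0 : Hyp.Rogawski1990_Sec14_6_Partition R) (hR1 : Hyp.Rogawski1990_Thm14_6_4 R)
    (hR2 : Hyp.Rogawski1990_Thm14_6_5 R) (hs : ∀ P' ∈ R.Ps, ∀ π, R.mem π P' → R.m π ≤ 1)
    (hst : M.d3.AutStable) (hRbr : M.d3.RogawskiBridge R hst) (hO : M.d3.AutOrthogonal)
    (hsimp : M.d3.AutSimple) (hPX : M.d3.ProductsIn20 M.d3.A)
    (hPeqX : M.d3.ProductEquivariant M.d3.A) (hPY : M.d3.ProductsIn20 M.d3.B)
    (hPeqY : M.d3.ProductEquivariant M.d3.B) (hσX : M.d3.SigmaIsAut M.d3.A)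
    (hσ : M.d3.B.σ = M.d3.A.σ) :
    M.ellA → M.ellB →
      ∃ (φa : M.d3.A.Sa) (φb : M.d3.A.Sb) (φc : M.d3.B.Sa) (φd : M.d3.B.Sb),
        M.AdmData (φa, φb, φc, φd) ∧ ⟪M.d3.B.F φc φd, M.d3.A.F φa φb⟫_ℂ ≠ 0 :=
  N3iso_main₂ M (M.d2.admGenerating_of_admSpanning hAdm) R hR0 hR1 hR2 hs hst hRbr hO hsimp hPX
    hPeqX hPY hPeqY hσX hσ

/-- `N3iso_main₂` with the sentence DISCHARGED: when the four admissible sets of the N2 datum are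
everything (t6-p5's toy `T6N2Toy`, `admA = … = Set.univ`), the binder `hAdm` is not needed. -/
theorem N3iso_main₂_of_univ (hA : M.d2.admA = Set.univ) (hB : M.d2.admB = Set.univ)
    (hC : M.d2.admC = Set.univ) (hD : M.d2.admD = Set.univ) (R : RogawskiPackets)
    (hR0 : Hyp.Rogawski1990_Sec14_6_Partition R) (hR1 : Hyp.Rogawski1990_Thm14_6_4 R)
    (hR2 : Hyp.Rogawski1990_Thm14_6_5 R) (hs : ∀ P' ∈ R.Ps, ∀ π, R.mem π P' → R.m π ≤ 1)
    (hst : M.d3.AutStable) (hRbr : M.d3.RogawskiBridge R hst) (hO : M.d3.AutOrthogonal)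
    (hsimp : M.d3.AutSimple) (hPX : M.d3.ProductsIn20 M.d3.A)
    (hPeqX : M.d3.ProductEquivariant M.d3.A) (hPY : M.d3.ProductsIn20 M.d3.B)
    (hPeqY : M.d3.ProductEquivariant M.d3.B) (hσX : M.d3.SigmaIsAut M.d3.A)
    (hσ : M.d3.B.σ = M.d3.A.σ) :
    M.ellA → M.ellB →
      ∃ (φa : M.d3.A.Sa) (φb : M.d3.A.Sb) (φc : M.d3.B.Sa) (φd : M.d3.B.Sb),
        M.AdmData (φa, φb, φc, φd) ∧ ⟪M.d3.B.F φc φd, M.d3.A.F φa φb⟫_ℂ ≠ 0 :=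
  N3iso_main₂_of_admSpanning M (M.d2.admSpanning_of_univ hA hB hC hD) R hR0 hR1 hR2 hs hst hRbr hO
    hsimp hPX hPeqX hPY hPeqY hσX hσ

/-- N3iso, v2, on the STABLE route (for admissible products generating a proper submodule): the spans
of the admissible sets stable under the Weil representations (`M.d2.AdmStable`) and `ℓ^σ ≢ 0` already
on an admissible product on each side (`ellNonzeroOn`), in place of `hAdm` and `M.ellA`, `M.ellB`.
Same displays and residual binders as `N3iso_main₂`. -/
theorem N3iso_main₂_stable (hAdmSt : M.d2.AdmStable) (R : RogawskiPackets)
    (hR0 : Hyp.Rogawski1990_Sec14_6_Partition R) (hR1 : Hyp.Rogawski1990_Thm14_6_4 R)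
    (hR2 : Hyp.Rogawski1990_Thm14_6_5 R) (hs : ∀ P' ∈ R.Ps, ∀ π, R.mem π P' → R.m π ≤ 1)
    (hst : M.d3.AutStable) (hRbr : M.d3.RogawskiBridge R hst) (hO : M.d3.AutOrthogonal)
    (hsimp : M.d3.AutSimple) (hPX : M.d3.ProductsIn20 M.d3.A)
    (hPeqX : M.d3.ProductEquivariant M.d3.A) (hPY : M.d3.ProductsIn20 M.d3.B)
    (hPeqY : M.d3.ProductEquivariant M.d3.B) (hσX : M.d3.SigmaIsAut M.d3.A)
    (hσ : M.d3.B.σ = M.d3.A.σ) (hA : M.d3.ellNonzeroOn M.d3.A M.d2.admA M.d2.admB)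
    (hB : M.d3.ellNonzeroOn M.d3.B M.d2.admC M.d2.admD) :
    ∃ (φa : M.d3.A.Sa) (φb : M.d3.A.Sb) (φc : M.d3.B.Sa) (φd : M.d3.B.Sb),
      M.AdmData (φa, φb, φc, φd) ∧ ⟪M.d3.B.F φc φd, M.d3.A.F φa φb⟫_ℂ ≠ 0 :=
  M.d2.N3iso_of_datum₂_stable hAdmSt hO hst hsimp
    (hRbr (R.multLeOne_of_displays hR0 hR1 hR2 hs)) hPX hPeqX hPY hPeqY hσX hσ hA hB

end Summit.Ventures.HodgeRepro2.T6.N3Main
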